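import Literature.NumberTheory.Automorphic.SpreadIntertwiner
import Literature.NumberTheory.Automorphic.CuspidalGardingFixedPairSame
import Literature.NumberTheory.Automorphic.PairLFunctionNeConjLevelOneOfArch
import HarnessLib

/-!
# The spread PAIR datum: realising two archimedean vectors inside one cuspidal representation, at a
# common level, with a common fixing test function and spread Whittaker coefficients

Topic `NumberTheory/Automorphic`; namespace `Literature.NumberTheory.Automorphic`. Theorems only. A step
of the proof of the pole of `L^S(s, π × π̃)` at `s = 1` for cuspidal `π` on `GL_{n+1}(𝔸_K)`
(Jacquet–Shalika (1981), §4–§5; Arthur–Clozel (1989), Ch. 3 (2.3); Cogdell (2004), §4.1) from an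
ARCHIMEDEAN test-vector statement: an archimedean datum — two `K_∞`-finite Gårding vectors `e, e'` of
the archimedean component `τ = π_∞` — is realised GLOBALLY by the two cusp forms `T e`, `T e'` for ONE
bounded `G_∞`-intertwiner `T : τ → π` which is

* spread at the finite places of a finite set `T ⊇ T₀` (`T = E_L ∘ T₀`, `SpreadIntertwiner`), so that the
  Whittaker coefficient of `T e` is spread bi-equivariant at every `v ∈ T` with the torus parameters of
  the support theorem (`exists_spreadDatum` pattern of `PairLFunctionPolesEqConjArch`);
* of level `K_f(𝔫)` for an ideal `𝔫 ≠ 0` with prime factors in `T` and `|𝔫|_v ≤ q_v^{-m}` at `v ∈ T`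
  (`m` the depth of the thin test function);
* normalised in the finite Whittaker model: `Λ₀(T) = Λ₀(T₀)` for the line datum `(T₀, Λ₀)` of
  `WhittakerArchFinFactorization` (`finWhittaker_spreadIter_intertwiner_eq`);

and both `T e`, `T e'` are fixed by ONE test function `η`, left invariant under `K(𝔫)`
(`exists_testFunction_smoothedVector_eq_pairSame`). Main statement: `exists_spreadPairDatum`.

## References

* H. Jacquet, J. A. Shalika, *On Euler products … I*, Amer. J. Math. 103 (1981), §4–§5 [JacquetShalikaAJM1981].
* J. Arthur, L. Clozel, *Simple algebras, base change, and the advanced theory of the trace formula*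
  (1989), Ch. 3 §2 (2.3) [ArthurClozelAMS120].
* J. W. Cogdell, *Analytic theory of L-functions for GL_n* (2004), §1.2, §4.1 [CogdellAnalyticTheory2004].
-/

noncomputable section

open MeasureTheory Measure NumberField NumberField.mixedEmbedding IsDedekindDomain Matrix WithZero Set Filter
open scoped MatrixGroups ComplexConjugate Topology NNReal Classical
open Literature.NumberTheory.Automorphic.WhittakerSupport

namespace Literature.NumberTheory.Automorphic

/-! ### Ideals and levels -/

section Ideals

variable {n : ℕ} {K : Type} [Field K] [NumberField K]

/-- **The radius of `𝔫_L` at a place `v ∈ L` (`L` without repetition) is `exp(-k_v) |𝔫₁|_v`.** [folklore] -/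
theorem idealRadius_spreadLevelIdeal_of_mem {𝔫₁ : Ideal (𝓞 K)} (h𝔫₁ : 𝔫₁ ≠ 0) (k : HeightOneSpectrum (𝓞 K) → ℕ)
    {L : List (HeightOneSpectrum (𝓞 K))} (hnd : L.Nodup) {v : HeightOneSpectrum (𝓞 K)} (hv : v ∈ L) :
    idealRadius K v (spreadLevelIdeal 𝔫₁ k L) = exp (-(k v : ℤ)) * idealRadius K v 𝔫₁ := by
  induction L with
  | nil => exact absurd hv List.not_mem_nil
  | cons w L ih =>
    rw [List.nodup_cons] at hnd
    rcases List.mem_cons.1 hv with rfl | hvL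
    · exact idealRadius_spreadLevelIdeal_cons_self h𝔫₁ k hnd.1
    · have hvw : v ≠ w := fun h => hnd.1 (h ▸ hvL)
      rw [spreadLevelIdeal_cons, idealRadius_mul v (pow_ne_zero _ w.ne_bot) (spreadLevelIdeal_ne_zero h𝔫₁ k L),
        idealRadius_pow_of_ne hvw, one_mul, ih hnd.2 hvL]

/-- `|𝔫_L|_v ≤ |𝔫₁|_v` at every place. [folklore] -/
theorem idealRadius_spreadLevelIdeal_le {𝔫₁ : Ideal (𝓞 K)} (h𝔫₁ : 𝔫₁ ≠ 0) (k : HeightOneSpectrum (𝓞 K) → ℕ)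
    (L : List (HeightOneSpectrum (𝓞 K))) (v : HeightOneSpectrum (𝓞 K)) :
    idealRadius K v (spreadLevelIdeal 𝔫₁ k L) ≤ idealRadius K v 𝔫₁ := by
  unfold spreadLevelIdeal
  rw [idealRadius_mul v h𝔫₁ (prod_pow_ne_zero k L)]
  exact mul_le_of_le_one_right' (idealRadius_le_one K v _)

variable (n) in
/-- **`K(𝔫) ≤ K(𝔫')` when `|𝔫|_v ≤ |𝔫'|_v` at every place** (`valuedCongruenceSubgroup_mono`). [folklore] -/
theorem principalCongruenceLevel_le_of_idealRadius_le {𝔫 𝔫' : Ideal (𝓞 K)}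
    (h : ∀ v : HeightOneSpectrum (𝓞 K), idealRadius K v 𝔫 ≤ idealRadius K v 𝔫') :
    principalCongruenceLevel n K 𝔫 ≤ principalCongruenceLevel n K 𝔫' :=
  inf_le_inf_left _ (iInf_mono fun v => Subgroup.comap_mono (valuedCongruenceSubgroup_mono (Fin n) (h v)))

variable (n) in
/-- `K_f(𝔫) ≤ K_f(𝔫')` when `|𝔫|_v ≤ |𝔫'|_v` at every place. [folklore] -/
theorem finitePrincipalCongruenceLevel_le_of_idealRadius_le {𝔫 𝔫' : Ideal (𝓞 K)}
    (h : ∀ v : HeightOneSpectrum (𝓞 K), idealRadius K v 𝔫 ≤ idealRadius K v 𝔫') :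
    finitePrincipalCongruenceLevel n K 𝔫 ≤ finitePrincipalCongruenceLevel n K 𝔫' :=
  Subgroup.comap_mono (principalCongruenceLevel_le_of_idealRadius_le n h)

end Ideals

/-! ### The datum -/

section Datum

variable {n : ℕ} {K : Type} [Field K] [NumberField K]
variable {μ : Measure (AdelicGroupData.gl (n + 1) K).automorphicQuotient} [(AdelicGroupData.gl (n + 1) K).IsAutomorphicMeasure μ]

-- the house Borel structures, as in `SpreadIntertwiner`
attribute [local instance] adelicBorel borelSpace_adelic locallyCompactSpace_adelic secondCountableTopology_gl_adelic
  glAdeleBorel borelSpace_glAdele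
attribute [local instance] glLocalBorel borelSpace_glLocal

variable {hcpt : isCompact_glFiniteIntegralLevel (n + 1) K}
  {E : Type*} [NormedAddCommGroup E] [InnerProductSpace ℂ E] [CompleteSpace E]
  {τ : ContRepresentation ℂ (AutomorphyDatum.gl (n + 1) K hcpt).arch.carrier E}

omit [CompleteSpace E] in
/-- `Hom_{G_∞}(τ, W^{U₀}) ⊆ Hom_{G_∞}(τ, W^{U₁})` for `U₁ ≤ U₀`. [folklore] -/
theorem archIntertwinersLevel_antitone {W : ContRepresentation.ClosedSubrep ((AdelicGroupData.gl (n + 1) K).rightRegular μ)}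
    {U₀ U₁ : Subgroup (GL (Fin (n + 1)) (FiniteAdeleRing (𝓞 K) K))} (h : U₁ ≤ U₀)
    {T : E →L[ℂ] (AdelicGroupData.gl (n + 1) K).L2 μ} (hT : T ∈ archIntertwinersLevel hcpt τ W U₀) :
    T ∈ archIntertwinersLevel hcpt τ W U₁ :=
  ⟨hT.1, fun x => mem_levelPiece_iff.2 ⟨(mem_levelPiece_iff.1 (hT.2 x)).1,
    fun u hu => (mem_levelPiece_iff.1 (hT.2 x)).2 u (h hu)⟩⟩

set_option maxHeartbeats 1600000 in
set_option synthInstance.maxHeartbeats 200000 in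
set_option backward.isDefEq.respectTransparency false in
/-- **The spread pair datum.** Let `π` be a cuspidal automorphic representation of `GL_{n+1}(𝔸_K)` with
archimedean component `τ` (strongly continuous on `E`), `ν₀` a Haar measure on `N(𝔸_K)`, `(T₀, Λ₀)` a line
datum of the finite Whittaker model (`Φ_ℓ(T) = Λ₀(T) Φ_ℓ(T₀)` for all `T` in the multiplicity module,
`Φ_ℓ(T₀) ≠ 0`, with `ℓ` the `ψ`-Whittaker functional of `π` for `ν₀`), `e, e'` two `K_∞`-finite Gårding
vectors of `τ` and `T₀'` a finite set of finite places. Then there are `T ⊇ T₀'`, a depth `m ≥ 1`, an ideal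
`𝔫 ≠ 0` with prime factors in `T` and `|𝔫|_v ≤ q_v^{-m}` for `v ∈ T`, an element `T_sp` of the
multiplicity module of level `K_f(𝔫)` with `Λ₀(T_sp) = Λ₀(T₀)`, and ONE test function `η`, left
`K(𝔫)`-invariant, fixing both cusp forms `T_sp e` and `T_sp e'`, such that the Whittaker coefficient of
`S_η(T_sp e) = T_sp e` is spread bi-equivariant at every `v ∈ T` for torus parameters satisfying the
hypotheses of the support theorem `valued_eq_one_of_torusIntegrand_thin_ne_zero` with the depth `m`.
[cite: JacquetShalikaAJM1981, §4–§5] [cite: ArthurClozelAMS120, Ch. 3 §2 (2.3)] -/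
theorem exists_spreadPairDatum (P : CuspidalAutomorphicRepGL (n + 1) K μ) (hτ : τ.IsStronglyContinuous)
    (ν₀ : Measure ↥(adelicUnipotent (n + 1) K)) [IsHaarMeasure ν₀]
    {T₀ : multiplicityModule hcpt τ P.1} {Λ₀ : multiplicityModule hcpt τ P.1 →ₗ[ℂ] ℂ}
    (hne : transferMap (whittakerFunctional ν₀ (continuous_adeleAddChar K)
      (ContRepresentation.Equiv.refl P.1.toContRep)) hτ T₀ ≠ 0)
    (hΛ : ∀ T : multiplicityModule hcpt τ P.1,
      transferMap (whittakerFunctional ν₀ (continuous_adeleAddChar K)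
        (ContRepresentation.Equiv.refl P.1.toContRep)) hτ T =
        Λ₀ T • transferMap (whittakerFunctional ν₀ (continuous_adeleAddChar K)
          (ContRepresentation.Equiv.refl P.1.toContRep)) hτ T₀)
    (e e' : archGardingSpace hcpt τ)
    (hefin : FiniteDimensional ℂ (Submodule.span ℂ (Set.range
      fun κ : (AutomorphyDatum.gl (n + 1) K hcpt).arch.maximalCompact =>
        τ (toArch hcpt (κ : GL (Fin (n + 1)) (mixedSpace K))) (e : E))))
    (he'fin : FiniteDimensional ℂ (Submodule.span ℂ (Set.range
      fun κ : (AutomorphyDatum.gl (n + 1) K hcpt).arch.maximalCompact =>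
        τ (toArch hcpt (κ : GL (Fin (n + 1)) (mixedSpace K))) (e' : E))))
    (T₀' : Finset (HeightOneSpectrum (𝓞 K))) :
    ∃ (T : Finset (HeightOneSpectrum (𝓞 K))) (_ : T₀' ⊆ T) (m : ℕ) (𝔫 : Ideal (𝓞 K)) (_ : 𝔫 ≠ 0)
      (_ : ∀ v : HeightOneSpectrum (𝓞 K), v.asIdeal ∣ 𝔫 → v ∈ T)
      (Tsp : multiplicityModule hcpt τ P.1) (η : GL (Fin (n + 1)) (AdeleRing (𝓞 K) K) → ℝ),
      IsTestFunctionGL (n + 1) K η ∧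
      (∀ k : (AdelicGroupData.gl (n + 1) K).Adelic, k ∈ principalCongruenceLevel (n + 1) K 𝔫 →
        ∀ g : (AdelicGroupData.gl (n + 1) K).Adelic, η (k * g) = η g) ∧
      1 ≤ m ∧ (∀ v ∈ T, idealRadius K v 𝔫 ≤ exp (-(m : ℤ))) ∧
      Λ₀ Tsp = Λ₀ T₀ ∧
      (Tsp : E →L[ℂ] (AdelicGroupData.gl (n + 1) K).L2 μ) ∈
        archIntertwinersLevel hcpt τ P.1 (finitePrincipalCongruenceLevel (n + 1) K 𝔫) ∧
      smoothedVector P.1 η ⟨(Tsp : E →L[ℂ] (AdelicGroupData.gl (n + 1) K).L2 μ) (e : E),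
          apply_mem_of_mem_multiplicityModule Tsp e⟩ =
        ⟨(Tsp : E →L[ℂ] (AdelicGroupData.gl (n + 1) K).L2 μ) (e : E), apply_mem_of_mem_multiplicityModule Tsp e⟩ ∧
      smoothedVector P.1 η ⟨(Tsp : E →L[ℂ] (AdelicGroupData.gl (n + 1) K).L2 μ) (e' : E),
          apply_mem_of_mem_multiplicityModule Tsp e'⟩ =
        ⟨(Tsp : E →L[ℂ] (AdelicGroupData.gl (n + 1) K).L2 μ) (e' : E), apply_mem_of_mem_multiplicityModule Tsp e'⟩ ∧
      ∀ v ∈ T, ∃ (t : Fin (n + 1) → (v.adicCompletion K)ˣ) (M c₀ : ℤ),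
        IsSpreadWhittakerAt v (adeleAddChar K) t M
          (whittakerCoeff ν₀ (unipotentTateDomain (n + 1) K) (adeleAddChar K)
            (invQuot (AdelicGroupData.gl (n + 1) K)
              (smoothedForm η ((Tsp : E →L[ℂ] (AdelicGroupData.gl (n + 1) K).L2 μ) (e : E))))) ∧
        (∃ x : v.adicCompletion K, Valued.v x ≤ exp (1 - c₀) ∧ (adeleAddChar K).adicComponent v x ≠ 1) ∧ 1 ≤ M ∧
        (∀ i j : Fin (n + 1), i ≤ j → Valued.v (t j : v.adicCompletion K) ≤ Valued.v (t i : v.adicCompletion K)) ∧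
        (∀ i j : Fin (n + 1), (i : ℕ) + 1 = j →
          exp (M - c₀) * Valued.v (t j : v.adicCompletion K) ≤ Valued.v (t i : v.adicCompletion K)) ∧
        exp (-(m : ℤ)) * Valued.v (t 0 : v.adicCompletion K) ≤
          exp (-M) * Valued.v (t (Fin.last n) : v.adicCompletion K) := by
  classical
  -- (0) a principal level `𝔫₁` of `T₀`
  obtain ⟨U₀, hU₀o, hU₀c, hT₀U⟩ := T₀.2
  obtain ⟨𝔫₁, h𝔫₁, hle, -⟩ := exists_principalCongruenceLevel_le_of_mem_finiteLevelsGL (n := n + 1) (K := K)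
    ⟨U₀, hU₀o, hU₀c, rfl⟩ univ_mem
  have hKU₀ : finitePrincipalCongruenceLevel (n + 1) K 𝔫₁ ≤ U₀ := by
    intro u hu
    obtain ⟨u', hu', he⟩ := Subgroup.mem_map.1 (hle (mem_finitePrincipalCongruenceLevel_iff.1 hu))
    have : u' = u := by
      have h := congrArg (GLn.sndHom (n + 1) K) he
      rwa [GLn.sndHom_ofFinite, GLn.sndHom_ofFinite] at h
    rwa [← this]
  have hT₀lev : (T₀ : E →L[ℂ] (AdelicGroupData.gl (n + 1) K).L2 μ) ∈
      archIntertwinersLevel hcpt τ P.1 (finitePrincipalCongruenceLevel (n + 1) K 𝔫₁) :=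
    archIntertwinersLevel_antitone hKU₀ hT₀U
  -- (1) per-place data, exactly as in `exists_spreadDatum`
  have hcond : ∀ v : HeightOneSpectrum (𝓞 K), ∃ d : ℤ, ((adeleAddChar K).adicComponent v).HasConductorExp d := fun v =>
    ((isGlobalAddChar_adeleAddChar (K := K)).isContinuousNontrivial_adicComponent
      (adicComponent_adeleAddChar_ne_one v)).exists_hasConductorExp
  choose c hc using hcond
  obtain ⟨ϖ, hϖ⟩ := exists_uniformizers (K := K)
  set cnt : HeightOneSpectrum (𝓞 K) → ℕ := fun v => (Associates.mk v.asIdeal).count (Associates.mk 𝔫₁).factors with hcnt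
  set eL : HeightOneSpectrum (𝓞 K) → ℤ := fun v => max (max (c v) 0) (cnt v : ℤ) with heL
  have hH : ∀ v, SpreadHyp (K := K) c eL ϖ v := fun v =>
    { cond := fun y hy => (hc v).1 y ((mem_primePowBall_adicCompletion_iff (v := v)).2 hy)
      e_nonneg := le_trans (le_max_right _ _) (le_max_left _ _)
      c_le_e := le_trans (le_max_left _ _) (le_max_left _ _)
      unif := hϖ v }
  have hrad : ∀ v, exp (-eL v) ≤ idealRadius K v 𝔫₁ := fun v => by
    rw [idealRadius_eq_exp_neg_natCast v h𝔫₁, exp_le_exp, neg_le_neg_iff]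
    exact le_max_right _ _
  -- (2) the places and the first level
  set T : Finset (HeightOneSpectrum (𝓞 K)) := T₀' ∪ (Ideal.finite_factors h𝔫₁).toFinset with hT
  set L : List (HeightOneSpectrum (𝓞 K)) := T.toList with hL
  have hnd : L.Nodup := Finset.nodup_toList T
  have hLT : ∀ v, v ∈ L ↔ v ∈ T := fun v => Finset.mem_toList
  set k : HeightOneSpectrum (𝓞 K) → ℕ := fun v => spreadK (n + 1) (c v) (eL v) with hk
  set 𝔫L : Ideal (𝓞 K) := spreadLevelIdeal 𝔫₁ k L with h𝔫Ldef
  have h𝔫L : 𝔫L ≠ 0 := spreadLevelIdeal_ne_zero h𝔫₁ k L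
  -- (3) the spread intertwiner and its normalisation
  obtain ⟨TL, hTL, hTLeq⟩ := exists_spreadIter_intertwiner (W := P.1) (c := c) (e := eL) (ϖ := ϖ) h𝔫₁
    (fun v _ => hH v) hnd hT₀lev
  set Tsp : multiplicityModule hcpt τ P.1 := ⟨TL, finitePrincipalCongruenceLevel (n + 1) K 𝔫L,
    isOpen_finitePrincipalCongruenceLevel (n + 1) K h𝔫L, isCompact_finitePrincipalCongruenceLevel (n + 1) K h𝔫L, hTL⟩
    with hTsp
  have hΛeq : Λ₀ Tsp = Λ₀ T₀ :=
    finWhittaker_spreadIter_intertwiner_eq hτ ν₀ h𝔫₁ (fun v _ => hH v) hnd (fun v _ => hrad v) hne hΛ T₀ Tsp hT₀lev hTLeq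
  -- (4) the depth and the final level `𝔫 = 𝔫_L ∏_{v ∈ T} 𝔭_v^m`
  set m : ℕ := 1 + ∑ v ∈ T, (spreadM (c v) (eL v) + n * (spreadM (c v) (eL v) - c v)).toNat with hm
  have hmv : ∀ v ∈ T, spreadM (c v) (eL v) + n * (spreadM (c v) (eL v) - c v) ≤ m := by
    intro v hv
    have h1 : (spreadM (c v) (eL v) + n * (spreadM (c v) (eL v) - c v)).toNat ≤
        ∑ w ∈ T, (spreadM (c w) (eL w) + n * (spreadM (c w) (eL w) - c w)).toNat :=
      Finset.single_le_sum (f := fun w => (spreadM (c w) (eL w) + n * (spreadM (c w) (eL w) - c w)).toNat)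
        (fun _ _ => Nat.zero_le _) hv
    have h2 := Int.self_le_toNat (spreadM (c v) (eL v) + n * (spreadM (c v) (eL v) - c v))
    have h3 : ((∑ w ∈ T, (spreadM (c w) (eL w) + n * (spreadM (c w) (eL w) - c w)).toNat : ℕ) : ℤ) ≤ (m : ℤ) := by
      rw [hm]; exact_mod_cast Nat.le_add_left _ _
    calc spreadM (c v) (eL v) + n * (spreadM (c v) (eL v) - c v)
        ≤ ((spreadM (c v) (eL v) + n * (spreadM (c v) (eL v) - c v)).toNat : ℤ) := h2
      _ ≤ ((∑ w ∈ T, (spreadM (c w) (eL w) + n * (spreadM (c w) (eL w) - c w)).toNat : ℕ) : ℤ) := by exact_mod_cast h1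
      _ ≤ m := h3
  set 𝔫 : Ideal (𝓞 K) := spreadLevelIdeal 𝔫L (fun _ => m) L with h𝔫def
  have h𝔫 : 𝔫 ≠ 0 := spreadLevelIdeal_ne_zero h𝔫L _ L
  have hprimes : ∀ v : HeightOneSpectrum (𝓞 K), v.asIdeal ∣ 𝔫 → v ∈ T := by
    intro v hv
    rcases mem_or_dvd_of_dvd_spreadLevelIdeal _ hv with h | h
    · rcases mem_or_dvd_of_dvd_spreadLevelIdeal k h with h' | h'
      · exact Finset.mem_union_right _ ((Ideal.finite_factors h𝔫₁).mem_toFinset.2 h')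
      · exact (hLT v).1 h'
    · exact (hLT v).1 h
  have hradius : ∀ v ∈ T, idealRadius K v 𝔫 ≤ exp (-(m : ℤ)) := by
    intro v hv
    rw [h𝔫def, idealRadius_spreadLevelIdeal_of_mem h𝔫L _ hnd ((hLT v).2 hv)]
    exact mul_le_of_le_one_right' (idealRadius_le_one K v _)
  have h𝔫le : ∀ v, idealRadius K v 𝔫 ≤ idealRadius K v 𝔫L := fun v => idealRadius_spreadLevelIdeal_le h𝔫L _ L v
  have hKle : finitePrincipalCongruenceLevel (n + 1) K 𝔫 ≤ finitePrincipalCongruenceLevel (n + 1) K 𝔫L :=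
    finitePrincipalCongruenceLevel_le_of_idealRadius_le (n + 1) h𝔫le
  have hTsplev : (Tsp : E →L[ℂ] (AdelicGroupData.gl (n + 1) K).L2 μ) ∈
      archIntertwinersLevel hcpt τ P.1 (finitePrincipalCongruenceLevel (n + 1) K 𝔫) :=
    archIntertwinersLevel_antitone hKle hTL
  -- (5) the two cusp forms and their invariance under `K(𝔫)`
  set u : P.1.toSubmodule := ⟨TL (e : E), apply_mem_of_mem_multiplicityModule Tsp e⟩ with hu
  set u' : P.1.toSubmodule := ⟨TL (e' : E), apply_mem_of_mem_multiplicityModule Tsp e'⟩ with hu'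
  have hfixlev : ∀ (x : E) (g : (AdelicGroupData.gl (n + 1) K).Adelic), g ∈ principalCongruenceLevel (n + 1) K 𝔫 →
      (AdelicGroupData.gl (n + 1) K).rightRegular μ g (TL x) = TL x := by
    intro x g hg
    have hg' : GLn.ofFinite (n + 1) K (GLn.sndHom (n + 1) K g) = g :=
      GLn.ofFinite_sndHom_of_mem (principalCongruenceLevel_le (n + 1) K 𝔫 hg)
    have hsnd : GLn.sndHom (n + 1) K g ∈ finitePrincipalCongruenceLevel (n + 1) K 𝔫 := by
      rw [mem_finitePrincipalCongruenceLevel_iff, hg']; exact hg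
    rw [← hg']
    exact (mem_levelPiece_iff.1 (hTsplev.2 x)).2 _ hsnd
  have hUu : ∀ g ∈ principalCongruenceLevel (n + 1) K 𝔫, P.1.toContRep g u = u := fun g hg =>
    Subtype.ext (by rw [ContRepresentation.ClosedSubrep.coe_toContRep_apply]; exact hfixlev (e : E) g hg)
  have hUu' : ∀ g ∈ principalCongruenceLevel (n + 1) K 𝔫, P.1.toContRep g u' = u' := fun g hg =>
    Subtype.ext (by rw [ContRepresentation.ClosedSubrep.coe_toContRep_apply]; exact hfixlev (e' : E) g hg)
  -- (6) `K_∞`-finiteness of the two cusp forms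
  have hfin : FiniteDimensional ℂ (Submodule.span ℂ (Set.range
      fun κ : (AutomorphyDatum.gl (n + 1) K hcpt).arch.maximalCompact =>
        P.1.toContRep ((AutomorphyDatum.gl (n + 1) K hcpt).ofK κ) u)) :=
    finiteDimensional_span_toContRep_ofK_of_mem_archIntertwiners P hTL.1 (e : E) hefin
  have hfin' : FiniteDimensional ℂ (Submodule.span ℂ (Set.range
      fun κ : (AutomorphyDatum.gl (n + 1) K hcpt).arch.maximalCompact =>
        P.1.toContRep ((AutomorphyDatum.gl (n + 1) K hcpt).ofK κ) u')) :=
    finiteDimensional_span_toContRep_ofK_of_mem_archIntertwiners P hTL.1 (e' : E) he'fin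
  -- (7) the common fixing test function
  have hUlev : principalCongruenceLevel (n + 1) K 𝔫 ∈ (AutomorphyDatum.gl (n + 1) K hcpt).finiteLevels := by
    rw [AutomorphyDatum.gl_finiteLevels]
    exact principalCongruenceLevel_mem_finiteLevelsGL_holds (n + 1) K h𝔫
  obtain ⟨η, hη, hηK, hfix, hfix'⟩ := exists_testFunction_smoothedVector_eq_pairSame hcpt P hUlev u u' hfin hfin' hUu hUu'
  -- (8) assemble; the spread data at `v ∈ T`
  refine ⟨T, Finset.subset_union_left, m, 𝔫, h𝔫, hprimes, Tsp, η, hη, hηK, by omega, hradius, hΛeq, hTsplev,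
    hfix, hfix', fun v hv => ?_⟩
  have hv' : v ∈ L := (hLT v).2 hv
  have hiso : ∀ h ∈ spreadLevelGroup (spreadTorus (n + 1) (ϖ v) (c v) (eL v)) (spreadM (c v) (eL v)),
      P.1.toContRep (GLn.ofLocal (n + 1) K v h) (smoothedVector P.1 η u) = spreadChar v h • smoothedVector P.1 η u := by
    intro h hh
    rw [hfix]
    exact isotypic_apply_of_spreadIter_intertwiner (fun v _ => hH v) hnd hT₀lev.1 hTL.1 hTLeq (e : E) v hv' h hh
  obtain ⟨x, hx, hx1⟩ := (hc v).2
  refine ⟨spreadTorus (n + 1) (ϖ v) (c v) (eL v), spreadM (c v) (eL v), c v,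
    isSpreadWhittakerAt_of_isotypic ν₀ (le_trans zero_le_one (one_le_spreadM (hH v).e_nonneg)) (hH v).hψ hη u hiso,
    ⟨x, ?_, hx1⟩, one_le_spreadM (hH v).e_nonneg, valuation_spreadTorus_antitone (hH v).e_nonneg (hH v).unif,
    valuation_spreadTorus_gap (hH v).unif, valuation_spreadTorus_depth (hH v).unif (hmv v hv)⟩
  have h1 := (mem_primePowBall_adicCompletion_iff (v := v)).1 hx
  rwa [show (-(c v - 1) : ℤ) = 1 - c v by ring] at h1

end Datum

end Literature.NumberTheory.Automorphic
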